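import Summits.ResolutionOfSingularities.ResolutionOfSingularities.Theorems.FrobeniusClosingSteerRadicandChainTwo
import Summits.ResolutionOfSingularities.ResolutionOfSingularities.Theorems.FrobeniusClosingSteerRadicandChainTransport
import Summits.ResolutionOfSingularities.ResolutionOfSingularities.Theorems.FrobeniusClosingSteerRadicandChainAdjoin
import Literature.AlgebraicGeometry.Resolution.AffineDomainDimension
import Literature.AlgebraicGeometry.Resolution.ExcellentClosedSubschemes
import Literature.AlgebraicGeometry.Resolution.ExcellentRingsEssFiniteType
import Mathlib.FieldTheory.KummerPolynomial
import Mathlib.RingTheory.Ideal.GoingUp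
import HarnessLib

/-!
# Crux `Steer` (stmt-ResolutionOfSingularities-16345), chain W4.1, R2 σ_top line: **K(2)** — realisation of the
# torsor germs inside one field, and the by-name leaf (Theses-free helper)

OURS (campaign `res-hironaka`, rung L ★L-G4, slot W4.1, seat `res-type-026` on res-L0-w41-plan-1's ORDER
2026-08-27T05:10:18Z; NOT a statement of the manuscript under review; AI review is weaker than expert review).
ASSEMBLES **K(2) = `∀ p prime, NoEternalIsolatedRadicandChain p 2`** (`L/w41/Sketch-R2-steered.lean`
fb4f9514a6cb98fe §3.1 VERBATIM at `c = 2`, bodies unfolded as in `NoEternalChainOne.noEternalIsolatedRadicandChain_one`),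
CONDITIONAL on the named fact `Lipman1978NoEternalNormalBranch` (p497185), from `false_of_realisation`
(`…RadicandChainTwo.lean`) and the transport / adjoin lemmas (`…RadicandChainTransport.lean`,
`…RadicandChainAdjoin.lean`) by REALISING the germs `T m = (S m)[X]/(X^p − f m)` in ONE field:
`L₀ := Frac(S 0) = Subfield.closure (S 0) ≤ L` contains every `S m` (NOT `L`, which may be perfect);
`pow_mul_ne_pow` (isolated ⇒ `f` is no `p`-th power of a fraction) makes `K′ := L₀[X]/(X^p − f 0)` a field;
`θ 0 := X`, `θ (m+1) := (θ m − g m)/x m`, so `(θ m)^p = f m`, `θ m = x m θ (m+1) + g m`; `R m := ψ(S m)[θ m]` is the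
image of the INJECTIVE `T m → K′` (`T m` a domain, integral over `S m`, kernel meets `S m` trivially), whence
`e m : T m ≃+* R m`; `R 0` is a local ring of `K′`, Noetherian, excellent; `R m → R (m+1)` is a quadratic transform;
`dim R m = 2`. Leaf: `RadicandChainTwo.noEternalIsolatedRadicandChain_two hL p hp`.
[cite: Lipman1978, Thm. p. 151] [cite: Artin1986, Thm. (1.1)] [cite: Cutkosky2014, §2.1]
[cite: Matsumura1987, Thm. 9.4, §32 p. 260] [folklore]
-/

noncomputable section

-- `Summit.<S>.<S>.…` duplicates the summit name by design (single-problem summit).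
set_option linter.dupNamespace false

open Polynomial IsLocalRing

namespace Summit.ResolutionOfSingularities.ResolutionOfSingularities.Theorems.SwitchingDichotomy

open Literature.AlgebraicGeometry.Resolution

namespace RadicandChainTwo

universe u

section NotPow

variable {S : Type u} [CommRing S] (p : ℕ) [hp : Fact p.Prime] [CharP S p] (f : S)

/-- Over a regular local ring `S` of dimension two, if the torsor germ `S[X]/(X^p − f)` has isolated singularity
then `c^p f ≠ a^p` for `c ≠ 0`, i.e. `f` is not a `p`-th power in `Frac S`: otherwise `w = cX − a` is a nilpotent
(`w^p = c^p f − a^p = 0`) with `X`-coordinate `c ≠ 0`, contradicting reducedness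
(`RadicandChainTwo.isReduced_of_isolated`). [folklore] -/
theorem pow_mul_ne_pow [IsRegularLocalRing S] (hdim : ringKrullDim S = (2 : ℕ))
    (hisol : ∀ (P : Ideal (AdjoinRoot ((X : S[X]) ^ p - C f))) [P.IsPrime],
      (∃ Q : Ideal (AdjoinRoot ((X : S[X]) ^ p - C f)), Q.IsPrime ∧ P < Q) →
      IsRegularLocalRing (Localization.AtPrime P))
    (a c : S) (hc : c ≠ 0) : c ^ p * f ≠ a ^ p := by
  classical
  intro hcf
  set F : S[X] := (X : S[X]) ^ p - C f with hF
  haveI := isDomain_of_isRegularLocalRing S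
  haveI hloc' : IsLocalRing (AdjoinRoot F) := isLocalRing_adjoinRoot_X_pow_sub_C_of_charP p f
  have hmon : F.Monic := NoEternalChainOne.monic_X_pow_sub_C' p f
  haveI : Module.Finite S (AdjoinRoot F) := hmon.finite_adjoinRoot
  haveI : Module.Free S (AdjoinRoot F) := hmon.free_adjoinRoot
  haveI : FaithfulSMul S (AdjoinRoot F) := inferInstance
  haveI : CharP (AdjoinRoot F) p := charP_of_injective_algebraMap' S p
  have hS : maximalIdeal S ≠ ⊥ := by
    intro h
    have h0 := ringKrullDim_eq_zero_of_isField ((isField_iff_maximalIdeal_eq).mpr h)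
    rw [hdim] at h0
    have h2 : (2 : ℕ) = 0 := by exact_mod_cast h0
    exact absurd h2 two_ne_zero
  haveI : IsReduced (AdjoinRoot F) := isReduced_of_isolated p f hS hisol
  set w : AdjoinRoot F := AdjoinRoot.of F c * AdjoinRoot.root F - AdjoinRoot.of F a with hw
  have hwp : w ^ p = 0 := by
    rw [hw, sub_pow_char, mul_pow, NoEternalChainOne.root_pow_eq, ← map_pow, ← map_pow, ← map_mul,
      ← map_sub, hcf, sub_self, map_zero]
  have hw0 : w = 0 := (IsReduced.eq_zero w ⟨p, hwp⟩)
  obtain ⟨lam, hlam1, hlam0⟩ := NoEternalChainOne.exists_coord_root p f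
  have h1 : lam w = c := by
    rw [hw, map_sub, hlam0, sub_zero]
    have h2 : AdjoinRoot.of F c * AdjoinRoot.root F = c • AdjoinRoot.root F := by
      rw [Algebra.smul_def, AdjoinRoot.algebraMap_eq]
    rw [h2, map_smul, hlam1, smul_eq_mul, mul_one]
  rw [hw0, map_zero] at h1
  exact hc h1.symm

end NotPow

section Subfield

variable {L : Type u} [Field L]

/-- A quadratic transform of a subring of the subfield `L₀` stays inside `L₀` (its elements are fractions over
the chart `S[𝔪/x] ⊆ L₀`). [cite: Cutkosky2014, §2.1] [folklore] -/
theorem mem_subfield_of_isQuadraticTransform (L₀ : Subfield L) {S S₁ : Subring L}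
    (h : IsQuadraticTransform S S₁) (hS : ∀ z ∈ S, z ∈ L₀) : ∀ z ∈ S₁, z ∈ L₀ := by
  obtain ⟨hSl, x, -, -, -, -, hfrac, -⟩ := h
  haveI := hSl
  have hbl : ∀ z ∈ blowupRing S (x : L), z ∈ L₀ := by
    intro z hz
    have hle : blowupRing S (x : L) ≤ L₀.toSubring := by
      unfold blowupRing
      refine Subring.closure_le.mpr ?_
      rintro w (hw | ⟨y, -, rfl⟩)
      · exact hS w hw
      · exact L₀.div_mem (hS _ y.2) (hS _ x.2)
    exact hle hz
  intro z hz
  obtain ⟨a, ha, b, hb, -, rfl⟩ := hfrac z hz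
  exact L₀.div_mem (hbl a ha) (hbl b hb)

/-- Every member of a chain of quadratic transforms lies in the subfield generated by the first one. [folklore] -/
theorem mem_subfield_closure_of_chain (S : ℕ → Subring L) (hQT : ∀ m, IsQuadraticTransform (S m) (S (m + 1)))
    (m : ℕ) : ∀ z ∈ S m, z ∈ Subfield.closure ((S 0 : Subring L) : Set L) := by
  induction m with
  | zero => exact fun z hz => Subfield.subset_closure hz
  | succ m ih => exact mem_subfield_of_isQuadraticTransform _ (hQT m) ih

/-- Elements of `Subfield.closure S` are fractions of elements of the subring `S`. [folklore] -/
theorem exists_div_eq_of_mem_subfield_closure (S : Subring L) {u : L}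
    (hu : u ∈ Subfield.closure ((S : Subring L) : Set L)) : ∃ a ∈ S, ∃ b ∈ S, u = a / b := by
  obtain ⟨a, ha, b, hb, rfl⟩ := Subfield.mem_closure_iff.mp hu
  rw [Subring.closure_eq] at ha hb
  exact ⟨a, ha, b, hb, rfl⟩

/-- For a subring `T ≤ ι(D)` and an injective `ψ : D → E`, the subring `ψ(ι⁻¹ T) ≤ E` is isomorphic to `T`, by an
isomorphism with the expected values. [folklore] -/
theorem exists_ringEquiv_comap_map {D E : Type u} [Field D] [Field E] (ι : D →+* L) (ψ : D →+* E)
    (T : Subring L) (sec : T → D) (hsec : ∀ t : T, ι (sec t) = t) :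
    ∃ e : T ≃+* (T.comap ι).map ψ, ∀ t : T, (e t : E) = ψ (sec t) := by
  have hT : T ≤ ι.range := fun z hz => ⟨sec ⟨z, hz⟩, hsec ⟨z, hz⟩⟩
  let e1 : T.comap ι ≃+* T :=
    ((T.comap ι).equivMapOfInjective ι ι.injective).trans (RingEquiv.subringCongr (Subring.map_comap_eq_self hT))
  let e2 : T.comap ι ≃+* (T.comap ι).map ψ := (T.comap ι).equivMapOfInjective ψ ψ.injective
  refine ⟨e1.symm.trans e2, fun t => ?_⟩
  have h1 : ∀ d : T.comap ι, (e1 d : L) = ι d := fun d => rfl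
  have h2 : ((e1.symm t : T.comap ι) : D) = sec t := by
    apply ι.injective
    rw [← h1, e1.apply_symm_apply, hsec]
  show (ψ ((e1.symm t : T.comap ι) : D)) = ψ (sec t)
  rw [h2]

end Subfield

/-- **K(2) — `NoEternalIsolatedRadicandChain p 2`, conditional on `Lipman1978NoEternalNormalBranch`** (idea-1's
statement, `L/w41/Sketch-R2-steered.lean` §3.1, VERBATIM with `c = 2` and `HasIsolatedSingularity` /
`RadicandRing` unfolded): there is no infinite sequence of quadratic transforms of excellent regular local rings of
dimension TWO inside a field of characteristic `p`, carrying radicands `f m` with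
`f (m+1) · (x m)^p = f m − (g m)^p` (`x m` the exceptional parameter), of multiplicity `p` after cleaning, with
isolated torsor singularity at every stage. Proof: realise the torsor germs `T m` as a branch `R m` of normal
two-dimensional quadratic transforms in the field `Frac(S 0)[X]/(X^p − f 0)` (module docstring) and apply
`false_of_realisation` (Lipman's theorem gives a regular member; the cleaned multiplicity makes every member
singular). By-name leaf for the composition's e-free K(2) slot:
`fun p hp => RadicandChainTwo.noEternalIsolatedRadicandChain_two hL p hp`.
[cite: Lipman1978, Thm. p. 151] [cite: Artin1986, Thm. (1.1)] [cite: Cutkosky2014, §2.1] [folklore] -/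
theorem noEternalIsolatedRadicandChain_two (hL : Lipman1978NoEternalNormalBranch.{0}) (p : ℕ) (hp : p.Prime) :
    ∀ (L : Type) [Field L] [CharP L p] (S : ℕ → Subring L) [∀ m, IsLocalRing (S m)]
      (hle : ∀ m, S m ≤ S (m + 1)) (f g : ∀ m, S m) (x : ∀ m, S (m + 1)),
      (∀ m, IsRegularLocalRing (S m)) → (∀ m, IsExcellentRing (S m)) → (∀ m, ringKrullDim (S m) = (2 : ℕ)) →
      (∀ m, IsQuadraticTransform (S m) (S (m + 1))) →
      (∀ m, Ideal.span ((fun y : S m => (⟨(y : L), hle m y.2⟩ : S (m + 1))) ''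
          (maximalIdeal (S m) : Set (S m))) = Ideal.span {x m}) →
      (∀ m, ((f (m + 1) : S (m + 1)) : L) * ((x m : S (m + 1)) : L) ^ p =
          ((f m : S m) : L) - ((g m : S m) : L) ^ p) →
      (∀ m, ∃ h : S m, f m - h ^ p ∈ maximalIdeal (S m) ^ p) →
      (∀ m, ∀ (P : Ideal (AdjoinRoot ((X : (S m)[X]) ^ p - C (f m)))) [P.IsPrime],
          (∃ Q : Ideal (AdjoinRoot ((X : (S m)[X]) ^ p - C (f m))), Q.IsPrime ∧ P < Q) →
          IsRegularLocalRing (Localization.AtPrime P)) →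
      False := by
  intro L _ _ S _ hle f g x hreg hexc hdim hQT hspan hrel hmult hisol
  classical
  haveI := Fact.mk hp
  have hmon : ∀ m, ((X : (S m)[X]) ^ p - C (f m)).Monic := fun m =>
    NoEternalChainOne.monic_X_pow_sub_C' p (f m)
  have hTloc : ∀ m, IsLocalRing (AdjoinRoot ((X : (S m)[X]) ^ p - C (f m))) := fun m =>
    isLocalRing_adjoinRoot_X_pow_sub_C_of_charP p (f m)
  have hTdom : ∀ m, IsDomain (AdjoinRoot ((X : (S m)[X]) ^ p - C (f m))) := fun m =>
    haveI := hreg m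
    isDomain_of_isolated p (f m) (hdim m) (hisol m)
  have hx0 : ∀ m, ((x m : S (m + 1)) : L) ≠ 0 := by
    intro m hxm
    haveI := hreg m
    have hbot : maximalIdeal (S m) = ⊥ := by
      rw [eq_bot_iff]
      intro y hy
      have h1 : (⟨(y : L), hle m y.2⟩ : S (m + 1)) ∈ Ideal.span {x m} :=
        hspan m ▸ Ideal.subset_span ⟨y, hy, rfl⟩
      obtain ⟨a, ha⟩ := Ideal.mem_span_singleton'.mp h1
      have h2 : (y : L) = 0 := by
        rw [← congrArg Subtype.val ha]
        show ((a : S (m + 1)) : L) * ((x m : S (m + 1)) : L) = 0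
        rw [hxm, mul_zero]
      exact (Submodule.mem_bot _).mpr (Subtype.ext h2)
    have h0 := ringKrullDim_eq_zero_of_isField ((isField_iff_maximalIdeal_eq).mpr hbot)
    rw [hdim m] at h0
    have h2 : (2 : ℕ) = 0 := by exact_mod_cast h0
    exact absurd h2 two_ne_zero
  set L₀ : Subfield L := Subfield.closure ((S 0 : Subring L) : Set L) with hL₀
  have hSL₀ : ∀ m, ∀ z ∈ S m, z ∈ L₀ := mem_subfield_closure_of_chain S hQT
  let ι : L₀ →+* L := L₀.subtype
  have hιrange : ∀ m, S m ≤ ι.range := fun m z hz => ⟨⟨z, hSL₀ m z hz⟩, rfl⟩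
  haveI : CharP L₀ p := RingHom.charP L₀.subtype L₀.subtype.injective p
  let f' : ∀ m, L₀ := fun m => ⟨((f m : S m) : L), hSL₀ m _ (f m).2⟩
  let g' : ∀ m, L₀ := fun m => ⟨((g m : S m) : L), hSL₀ m _ (g m).2⟩
  let x' : ∀ m, L₀ := fun m => ⟨((x m : S (m + 1)) : L), hSL₀ (m + 1) _ (x m).2⟩
  have hrel' : ∀ m, f' (m + 1) * x' m ^ p = f' m - g' m ^ p := fun m => Subtype.ext (hrel m)
  have hx'0 : ∀ m, x' m ≠ 0 := fun m h => hx0 m (congrArg Subtype.val h)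
  set F₀ : L₀[X] := (X : L₀[X]) ^ p - C (f' 0) with hF₀
  have hirr : Irreducible F₀ := by
    refine X_pow_sub_C_irreducible_of_prime hp fun b hb => ?_
    obtain ⟨a, ha, c, hc, hbac⟩ := exists_div_eq_of_mem_subfield_closure (S 0) b.2
    haveI := hreg 0
    rcases eq_or_ne c 0 with rfl | hc0
    · -- `b = a/0 = 0`, so `f 0 = 0 = 0^p`
      have hb0 : b = 0 := Subtype.ext (by rw [hbac, div_zero]; rfl)
      rw [hb0, zero_pow hp.ne_zero] at hb
      have hf0 : f 0 = 0 := Subtype.ext (congrArg Subtype.val hb).symm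
      refine pow_mul_ne_pow p (f 0) (hdim 0) (hisol 0) 0 1 one_ne_zero ?_
      rw [hf0, mul_zero, zero_pow hp.ne_zero]
    · refine pow_mul_ne_pow p (f 0) (hdim 0) (hisol 0) ⟨a, ha⟩ ⟨c, hc⟩
        (fun h => hc0 (congrArg Subtype.val h)) (Subtype.ext ?_)
      have hbL : (b : L) ^ p = ((f 0 : S 0) : L) := congrArg Subtype.val hb
      show c ^ p * ((f 0 : S 0) : L) = a ^ p
      rw [← hbL, hbac, div_pow, mul_div_cancel₀ _ (pow_ne_zero p hc0)]
  haveI : Fact (Irreducible F₀) := ⟨hirr⟩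
  let ψ : L₀ →+* AdjoinRoot F₀ := AdjoinRoot.of F₀
  have hψ : Function.Injective ψ := (AdjoinRoot.of F₀).injective
  haveI : CharP (AdjoinRoot F₀) p := charP_of_injective_ringHom hψ p
  have hψx0 : ∀ m, ψ (x' m) ≠ 0 := fun m h => hx'0 m (hψ (by rw [h, map_zero]))
  let θ : ℕ → AdjoinRoot F₀ := fun m =>
    Nat.rec (AdjoinRoot.root F₀) (fun m t => (t - ψ (g' m)) / ψ (x' m)) m
  have hθsucc : ∀ m, θ (m + 1) = (θ m - ψ (g' m)) / ψ (x' m) := fun m => rfl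
  have hθpow : ∀ m, θ m ^ p = ψ (f' m) := by
    intro m
    induction m with
    | zero =>
      have h := AdjoinRoot.eval₂_root F₀
      rw [hF₀, eval₂_sub, eval₂_X_pow, eval₂_C, sub_eq_zero] at h
      exact h
    | succ m ih =>
      rw [hθsucc, div_pow, sub_pow_char, ih, ← map_pow, ← map_sub, ← map_pow, ← hrel' m, map_mul, map_pow,
        mul_div_cancel_right₀ _ (pow_ne_zero p (hψx0 m))]
  have hθrel : ∀ m, θ m = ψ (x' m) * θ (m + 1) + ψ (g' m) := by
    intro m
    rw [hθsucc, mul_div_cancel₀ _ (hψx0 m), sub_add_cancel]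
  have heA : ∀ m, ∃ e : S m ≃+* ((S m).comap ι).map ψ, ∀ s : S m, (e s : AdjoinRoot F₀) =
      ψ ⟨(s : L), hSL₀ m _ s.2⟩ := fun m =>
    exists_ringEquiv_comap_map ι ψ (S m) (fun s => ⟨(s : L), hSL₀ m _ s.2⟩) (fun _ => rfl)
  choose eA heAval using heA
  have hAloc : ∀ m, IsLocalRing (((S m).comap ι).map ψ) := fun m => (eA m).isLocalRing
  let φ : ∀ m, S m →+* AdjoinRoot F₀ := fun m =>
    (Subring.subtype (((S m).comap ι).map ψ)).comp (eA m).toRingHom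
  have hφval : ∀ m (s : S m), φ m s = ψ ⟨(s : L), hSL₀ m _ s.2⟩ := fun m s => heAval m s
  have hφinj : ∀ m, Function.Injective (φ m) := fun m =>
    (Subring.subtype_injective _).comp (eA m).injective
  have hφrange : ∀ m, (φ m).range = ((S m).comap ι).map ψ := by
    intro m
    ext z
    constructor
    · rintro ⟨s, rfl⟩
      exact (eA m s).2
    · intro hz
      refine ⟨(eA m).symm ⟨z, hz⟩, ?_⟩
      show (((eA m) ((eA m).symm ⟨z, hz⟩) : ((S m).comap ι).map ψ) : AdjoinRoot F₀) = z
      rw [(eA m).apply_symm_apply]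
  have hFθ : ∀ m, ((X : (S m)[X]) ^ p - C (f m)).eval₂ (φ m) (θ m) = 0 := by
    intro m
    rw [eval₂_sub, eval₂_X_pow, eval₂_C, hθpow, hφval, sub_eq_zero]
  let τ : ∀ m, AdjoinRoot ((X : (S m)[X]) ^ p - C (f m)) →+* AdjoinRoot F₀ := fun m =>
    AdjoinRoot.lift (φ m) (θ m) (hFθ m)
  let R : ℕ → Subring (AdjoinRoot F₀) := fun m =>
    Subring.closure (((((S m).comap ι).map ψ : Subring (AdjoinRoot F₀)) : Set (AdjoinRoot F₀)) ∪ {θ m})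
  have hτrange : ∀ m, (τ m).range = R m := by
    intro m
    show (AdjoinRoot.lift (φ m) (θ m) (hFθ m)).range = _
    rw [RadicandChainAdjoin.range_adjoinRoot_lift, hφrange]
  have hτinj : ∀ m, Function.Injective (τ m) := by
    intro m
    haveI := hreg m
    haveI := hTdom m
    haveI : Module.Finite (S m) (AdjoinRoot ((X : (S m)[X]) ^ p - C (f m))) := (hmon m).finite_adjoinRoot
    haveI : Algebra.IsIntegral (S m) (AdjoinRoot ((X : (S m)[X]) ^ p - C (f m))) := inferInstance
    have hker : RingHom.ker (τ m) = ⊥ := by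
      apply Ideal.eq_bot_of_comap_eq_bot (R := S m)
      rw [eq_bot_iff]
      intro s hs
      rw [Ideal.mem_comap, RingHom.mem_ker, AdjoinRoot.algebraMap_eq] at hs
      have h1 : φ m s = 0 := by
        rw [← hs]
        exact (AdjoinRoot.lift_of (hFθ m)).symm
      exact (Submodule.mem_bot _).mpr ((injective_iff_map_eq_zero (φ m)).mp (hφinj m) s h1)
    exact (RingHom.injective_iff_ker_eq_bot _).mpr hker
  have he : ∀ m, ∃ e : AdjoinRoot ((X : (S m)[X]) ^ p - C (f m)) ≃+* R m,
      ∀ t, (e t : AdjoinRoot F₀) = τ m t := by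
    intro m
    have hbij : Function.Bijective (τ m).rangeRestrict :=
      ⟨fun a b h => hτinj m (congrArg Subtype.val h), RingHom.rangeRestrict_surjective _⟩
    exact ⟨(RingEquiv.ofBijective (τ m).rangeRestrict hbij).trans (RingEquiv.subringCongr (hτrange m)),
      fun t => rfl⟩
  choose e heval using he
  have hRloc : ∀ m, IsLocalRing (R m) := fun m =>
    haveI := hTloc m
    (e m).isLocalRing
  refine false_of_realisation hL S f hreg hdim hmult hisol R e ⟨hRloc 0, fun z => ?_⟩ ?_ ?_ ?_ ?_
  · -- every element of `K' = L₀[θ 0]` is a fraction over `R 0`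
    have hAR : ∀ {m} {z}, z ∈ ((S m).comap ι).map ψ → z ∈ R m := fun hz =>
      Subring.subset_closure (Or.inl hz)
    have hθR : ∀ m, θ m ∈ R m := fun m => Subring.subset_closure (Or.inr rfl)
    have good_add : ∀ z w : AdjoinRoot F₀,
        (∃ a ∈ R 0, ∃ b ∈ R 0, b ≠ 0 ∧ z = a / b) → (∃ a ∈ R 0, ∃ b ∈ R 0, b ≠ 0 ∧ w = a / b) →
        (∃ a ∈ R 0, ∃ b ∈ R 0, b ≠ 0 ∧ z + w = a / b) := by
      rintro z w ⟨a, ha, b, hb, hb0, rfl⟩ ⟨c, hc, d, hd, hd0, rfl⟩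
      exact ⟨a * d + b * c, add_mem (mul_mem ha hd) (mul_mem hb hc), b * d, mul_mem hb hd,
        mul_ne_zero hb0 hd0, div_add_div a c hb0 hd0⟩
    have good_mul : ∀ z w : AdjoinRoot F₀,
        (∃ a ∈ R 0, ∃ b ∈ R 0, b ≠ 0 ∧ z = a / b) → (∃ a ∈ R 0, ∃ b ∈ R 0, b ≠ 0 ∧ w = a / b) →
        (∃ a ∈ R 0, ∃ b ∈ R 0, b ≠ 0 ∧ z * w = a / b) := by
      rintro z w ⟨a, ha, b, hb, hb0, rfl⟩ ⟨c, hc, d, hd, hd0, rfl⟩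
      exact ⟨a * c, mul_mem ha hc, b * d, mul_mem hb hd, mul_ne_zero hb0 hd0, div_mul_div_comm a b c d⟩
    have good_of_mem : ∀ z ∈ R 0, ∃ a ∈ R 0, ∃ b ∈ R 0, b ≠ 0 ∧ z = a / b :=
      fun z hz => ⟨z, hz, 1, one_mem _, one_ne_zero, (div_one z).symm⟩
    have good_ψ : ∀ u : L₀, ∃ a ∈ R 0, ∃ b ∈ R 0, b ≠ 0 ∧ ψ u = a / b := by
      intro u
      obtain ⟨a, ha, c, hc, huac⟩ := exists_div_eq_of_mem_subfield_closure (S 0) u.2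
      have haR : ψ ⟨a, hSL₀ 0 a ha⟩ ∈ R 0 := hAR (by rw [← hφval 0 ⟨a, ha⟩]; exact (hφrange 0) ▸ ⟨_, rfl⟩)
      have hcR : ψ ⟨c, hSL₀ 0 c hc⟩ ∈ R 0 := hAR (by rw [← hφval 0 ⟨c, hc⟩]; exact (hφrange 0) ▸ ⟨_, rfl⟩)
      rcases eq_or_ne c 0 with rfl | hc0
      · have hu0 : u = 0 := Subtype.ext (by rw [huac, div_zero]; rfl)
        rw [hu0, map_zero]
        exact ⟨0, zero_mem _, 1, one_mem _, one_ne_zero, (div_one 0).symm⟩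
      · refine ⟨_, haR, _, hcR, fun h => hc0 ?_, ?_⟩
        · have := hψ (h.trans (map_zero ψ).symm)
          exact congrArg Subtype.val this
        · rw [← map_div₀]
          congr 1
          exact Subtype.ext huac
    obtain ⟨q, rfl⟩ := AdjoinRoot.mk_surjective z
    rw [← AdjoinRoot.aeval_eq, aeval_def, AdjoinRoot.algebraMap_eq]
    induction q using Polynomial.induction_on with
    | C u =>
      rw [eval₂_C]
      exact good_ψ u
    | add q₁ q₂ h₁ h₂ =>
      rw [eval₂_add]
      exact good_add _ _ h₁ h₂
    | monomial n u _ =>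
      rw [eval₂_mul, eval₂_C, eval₂_X_pow]
      exact good_mul _ _ (good_ψ u) (good_of_mem _ (pow_mem (hθR 0) (n + 1)))
  · -- Noetherian
    haveI : IsNoetherianRing (AdjoinRoot ((X : (S 0)[X]) ^ p - C (f 0))) :=
      inferInstanceAs (IsNoetherianRing ((S 0)[X] ⧸ Ideal.span {(X : (S 0)[X]) ^ p - C (f 0)}))
    exact isNoetherianRing_of_ringEquiv _ (e 0)
  · -- excellent
    haveI : Module.Finite (S 0) (AdjoinRoot ((X : (S 0)[X]) ^ p - C (f 0))) := (hmon 0).finite_adjoinRoot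
    exact ((hexc 0).of_finiteType' (B := AdjoinRoot ((X : (S 0)[X]) ^ p - C (f 0)))).of_ringEquiv (e 0)
  · -- quadratic transforms
    intro m
    haveI := hAloc m
    haveI := hAloc (m + 1)
    haveI := hRloc m
    haveI := hRloc (m + 1)
    have hAQ : IsQuadraticTransform (((S m).comap ι).map ψ) (((S (m + 1)).comap ι).map ψ) :=
      RadicandChainTransport.isQuadraticTransform_transport ι ψ (hQT m) (hιrange (m + 1))
    have hleA : ((S m).comap ι).map ψ ≤ ((S (m + 1)).comap ι).map ψ := hAQ.dominates.1
    have hcomp : ∀ y : S m, ((eA (m + 1)) ⟨(y : L), hle m y.2⟩ : AdjoinRoot F₀) = (eA m y : AdjoinRoot F₀) := by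
      intro y
      rw [heAval, heAval]
    have hspanA := RadicandChainTransport.span_maximalIdeal_transport (hle m) hleA (eA m) (eA (m + 1))
      hcomp (x m) (hspan m)
    refine RadicandChainAdjoin.isQuadraticTransform_adjoin hAQ hleA hp.ne_zero
      (eA m (f m)) (eA m (g m)) (eA (m + 1) (f (m + 1))) (eA (m + 1) (x m)) ?_ ?_ ?_ hspanA rfl rfl
    · rw [heAval]; exact hθpow m
    · rw [heAval]; exact hθpow (m + 1)
    · rw [heAval, heAval]; exact hθrel m
  · -- dimension two
    intro m
    haveI := hreg m
    haveI := hTdom m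
    haveI : Module.Finite (S m) (AdjoinRoot ((X : (S m)[X]) ^ p - C (f m))) := (hmon m).finite_adjoinRoot
    haveI : Module.Free (S m) (AdjoinRoot ((X : (S m)[X]) ^ p - C (f m))) := (hmon m).free_adjoinRoot
    haveI : Algebra.IsIntegral (S m) (AdjoinRoot ((X : (S m)[X]) ^ p - C (f m))) := inferInstance
    haveI : FaithfulSMul (S m) (AdjoinRoot ((X : (S m)[X]) ^ p - C (f m))) := inferInstance
    rw [← ringKrullDim_eq_of_ringEquiv (e m),
      ringKrullDim_eq_of_isIntegral (FaithfulSMul.algebraMap_injective (S m) _)]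
    exact hdim m

end RadicandChainTwo

end Summit.ResolutionOfSingularities.ResolutionOfSingularities.Theorems.SwitchingDichotomy

end
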